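import Summits.BirchSwinnertonDyer.BirchSwinnertonDyer.Theorems.PrintCFramBottomClassIndexLawFiveLeFlipRungSupply
import HarnessLib

/-!
# Crux `PrintCFram.BottomClassIndexLawFiveLe` (stmt-BirchSwinnertonDyer-20372), line `eisenstein-resource-bdp-line` (registry v28 → v29):
# BOTH FLIPPED-CUSP RUNGS WITHOUT EXCEPTION ⟹ v26's `stub_seedOffExc` WITH NO RESEARCH RESIDUE
# (cell `bsd-print-cfram`, LEAD g14 `bsd-line-cfram-p1`; THEOREMS ONLY, `--supports` 20372; BSD is not proved by any of this)

HONEST FRAMING. Nothing here is a statement about BSD; no registered stub is closed by this file alone. `…FlipRungSupply` (p706253) derived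
v26's analytic research stub `stub_seedOffExc` from the flipped-cusp rung (FlipRung⁶) — which carries the hypothesis `q* ≢ 1 (mod p)` at the flipped
prime — and a residue at the primes `q ≡ −1 (mod 4p)` and at `2`. Two width findings remove BOTH exceptions: (i) w7 g8's 2-ADIC RUNG (FlipRungTwo⁶)
(T6: the class at `2` of a seed — `d ≡ 1` vs `5 (mod 8)` — flips through the cusp `[[64a, b],[64M′, 64]]` of the `U_4`/`U_8`-image of the odd-cut
Cohen–Eisenstein form, with Gauss-sum weights of the θ-multiplier mod `8`, p-units; crux notes `w7g8-T6`); (ii) RAUM'S LOWER UNIPOTENT (w2 g15 finding,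
Raum 2023 Forum Math. 35 Prop. 2.3; w3 g19's kernel blueprint T8 with the rational trace trick; w6 g9's reading check): reading the single square class
through `[1 0; q²C 1]` couples the two Legendre classes at EVERY odd `q` with KLOOSTERMAN weights, never `≡ 0` mod an odd prime (Sawin's counting lemma) —
so the rung holds WITHOUT `q* ≢ 1 (mod p)`: **(FlipRungAll⁶)** := (FlipRung⁶) with that hypothesis deleted. This file is the registry glue for both at
once: §1 `seedOffExc_of_flipRungAll_of_flipRungTwo_cut (Q)` — the §3/§4 induction of `…FlipRungSupply{,Cut}` with NO bad case: flip every odd prime of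
`m` inert in `ℚ(√−p)` by (FlipRungAll⁶), flip the class at `2` by (FlipRungTwo⁶) when `2 ∣ m ∧ p ≢ 7 (mod 8)` (then `−p ≡ 5 (mod 8)`), read at `ℚ(√−p)`
through the CM reflection; a side condition `Q` threaded as in `…Cut` §4; §2 the instances: `Q := True` (v26 `stub_seedOffExc` VERBATIM) and w5 g7's
`hExcLiveGI` (live exponent + genus-internal carve-out) VERBATIM. With these, registry v29 has NO analytic research stub: crux ⟸ cite-only facts ∧
[(FlipRungAll⁶) ∧ (FlipRungTwo⁶), print-derivable, typing waves T1–T8 in flight] ∧ B1-level ∧ B1-sha⁰. beyond-print theorem: NO. BSD is not proved.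

References: [Raum2023RamanujanTypeII] Prop. 2.3; [Cohen1975] Thm. 3.1; [Katz1973] Cor. 1.6.2; crux notes lead-g14 §2.7, w7g8-T6, w3g19, w2g15.
-/

set_option autoImplicit false
-- summit-side namespace `Summit.BirchSwinnertonDyer.BirchSwinnertonDyer.…` (single-conjunct summit, D-0017 layout)
set_option linter.dupNamespace false

noncomputable section

open scoped Classical NumberTheorySymbols
open NumberField DirichletCharacter Literature.NumberTheory.LFunctions
  Literature.NumberTheory.EllipticCurves Literature.NumberTheory.EllipticCurves.KrizLi2019
  Literature.NumberTheory.Congruences Literature.NumberTheory.QuadraticFields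

namespace Summit.BirchSwinnertonDyer.BirchSwinnertonDyer.Theorems.PrintCFram.FlipRung

open Summit.BirchSwinnertonDyer.BirchSwinnertonDyer.Theorems.PrintCFram
open Summit.BirchSwinnertonDyer.BirchSwinnertonDyer.Theorems.PrintCFram.HeegnerFieldSupply
open Summit.BirchSwinnertonDyer.BirchSwinnertonDyer.Theorems.PrintCFram.KummerDictionary
open Summit.BirchSwinnertonDyer.Rank1Residual Summit.BirchSwinnertonDyer.Rank1Residual.X12.O11

variable {p : ℕ} [hp : Fact p.Prime]

/-! ## §1 The composition without exception, side condition threaded -/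

/-- **`stub_seedOffExc` CUT BY A SIDE CONDITION `Q` ⟸ (FlipRungAll⁶) ∧ (FlipRungTwo⁶) — NO research residue.** For ANY predicate `Q p m χ k`:
off nothing, assume no `m`-admissible `K₀` (every `q ∣ m` split, `d` odd `< −4`) has a unit field factor; then every `K₀` of the all-split pattern with
`3 ∤ d` (and `d ≡ 1 (8)` if `2 ∣ m`) has a non-unit one; flip one at a time EVERY odd `q ∣ m` inert in `ℚ(√−p)` by `hFlipAll` (no hypothesis on `q`);
if `2 ∣ m` and `p ≢ 7 (mod 8)` flip the class at `2` by `hFlipTwo` (`−p ≡ 5 (mod 8)` as `p ≡ 3 (mod 4)`); the pattern reached is that of `ℚ(√−p)`, whose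
field factor is the reflected class factor (`exists_cmField_fieldFactor_le_imp`) — a unit by regularity: contradiction. Nothing about BSD.
[cite: Raum2023RamanujanTypeII, Prop. 2.3 and Lemma 2.4] [cite: Cohen1975, Thm. 3.1] [cite: Katz1973, Cor. 1.6.2] [cite: Washington1997, Thm. 5.11] -/
theorem seedOffExc_of_flipRungAll_of_flipRungTwo_cut (Q : (p : ℕ) → [Fact p.Prime] → (m : ℕ) → DirichletCharacter ℚ_[p] m → ℕ → Prop)
    (hFlipAll : ∀ (p : ℕ) [Fact p.Prime] (m : ℕ) [NeZero m] (χ : DirichletCharacter ℚ_[p] m) (k : ℕ),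
      (p = 7 ∨ p = 11 ∨ p = 19 ∨ p = 43 ∨ p = 67 ∨ p = 163) →
      m.Coprime p → χ.IsPrimitive → χ.IsQuadratic → (k = (p + 1) / 4 ∨ k = (3 * p - 1) / 4) →
      2 ≤ k → k ≤ p - 2 → χ (-1) * (-1) ^ k = -1 →
      ∀ (τ : ℕ → ℤ) (q : ℕ), q.Prime → q ∣ m → q ≠ 2 →
      (∀ q' : ℕ, q'.Prime → q' ∣ m → q' ≠ 2 → (τ q' = 1 ∨ τ q' = -1)) →
      (∀ (K₀ : Type) [Field K₀] [NumberField K₀] (ε₀ : DirichletCharacter ℚ_[p] (NumberField.discr K₀).natAbs),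
        IsImaginaryQuadratic K₀ → Odd (NumberField.discr K₀) → NumberField.discr K₀ < -4 →
        ¬ ((3 : ℤ) ∣ NumberField.discr K₀) →
        (∀ q' : ℕ, q'.Prime → q' ∣ m → q' ≠ 2 → jacobiSym (NumberField.discr K₀) q' = τ q') →
        (2 ∣ m → NumberField.discr K₀ % 8 = 1) → IsKroneckerCharacterOf K₀ ε₀ →
        ‖(k : ℚ_[p])⁻¹ * @generalizedBernoulli ℚ_[p] _ _
            (changeLevel (dvd_mul_right m (NumberField.discr K₀).natAbs) χ *
              changeLevel (dvd_mul_left (NumberField.discr K₀).natAbs m) ε₀).conductor ⟨conductor_ne_zero _⟩ k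
            (changeLevel (dvd_mul_right m (NumberField.discr K₀).natAbs) χ *
              changeLevel (dvd_mul_left (NumberField.discr K₀).natAbs m) ε₀).primitiveCharacter‖ ≤ (p : ℝ)⁻¹) →
      ∀ (K₀ : Type) [Field K₀] [NumberField K₀] (ε₀ : DirichletCharacter ℚ_[p] (NumberField.discr K₀).natAbs),
        IsImaginaryQuadratic K₀ → Odd (NumberField.discr K₀) → NumberField.discr K₀ < -4 →
        ¬ ((3 : ℤ) ∣ NumberField.discr K₀) →
        (∀ q' : ℕ, q'.Prime → q' ∣ m → q' ≠ 2 → jacobiSym (NumberField.discr K₀) q' = (if q' = q then -τ q' else τ q')) →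
        (2 ∣ m → NumberField.discr K₀ % 8 = 1) → IsKroneckerCharacterOf K₀ ε₀ →
        ‖(k : ℚ_[p])⁻¹ * @generalizedBernoulli ℚ_[p] _ _
            (changeLevel (dvd_mul_right m (NumberField.discr K₀).natAbs) χ *
              changeLevel (dvd_mul_left (NumberField.discr K₀).natAbs m) ε₀).conductor ⟨conductor_ne_zero _⟩ k
            (changeLevel (dvd_mul_right m (NumberField.discr K₀).natAbs) χ *
              changeLevel (dvd_mul_left (NumberField.discr K₀).natAbs m) ε₀).primitiveCharacter‖ ≤ (p : ℝ)⁻¹)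
    (hFlipTwo : ∀ (p : ℕ) [Fact p.Prime] (m : ℕ) [NeZero m] (χ : DirichletCharacter ℚ_[p] m) (k : ℕ),
      (p = 7 ∨ p = 11 ∨ p = 19 ∨ p = 43 ∨ p = 67 ∨ p = 163) →
      m.Coprime p → χ.IsPrimitive → χ.IsQuadratic → (k = (p + 1) / 4 ∨ k = (3 * p - 1) / 4) →
      2 ≤ k → k ≤ p - 2 → χ (-1) * (-1) ^ k = -1 → 2 ∣ m →
      ∀ (τ : ℕ → ℤ), (∀ q' : ℕ, q'.Prime → q' ∣ m → q' ≠ 2 → (τ q' = 1 ∨ τ q' = -1)) →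
      (∀ (K₀ : Type) [Field K₀] [NumberField K₀] (ε₀ : DirichletCharacter ℚ_[p] (NumberField.discr K₀).natAbs),
        IsImaginaryQuadratic K₀ → Odd (NumberField.discr K₀) → NumberField.discr K₀ < -4 →
        ¬ ((3 : ℤ) ∣ NumberField.discr K₀) →
        (∀ q' : ℕ, q'.Prime → q' ∣ m → q' ≠ 2 → jacobiSym (NumberField.discr K₀) q' = τ q') →
        NumberField.discr K₀ % 8 = 1 → IsKroneckerCharacterOf K₀ ε₀ →
        ‖(k : ℚ_[p])⁻¹ * @generalizedBernoulli ℚ_[p] _ _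
            (changeLevel (dvd_mul_right m (NumberField.discr K₀).natAbs) χ *
              changeLevel (dvd_mul_left (NumberField.discr K₀).natAbs m) ε₀).conductor ⟨conductor_ne_zero _⟩ k
            (changeLevel (dvd_mul_right m (NumberField.discr K₀).natAbs) χ *
              changeLevel (dvd_mul_left (NumberField.discr K₀).natAbs m) ε₀).primitiveCharacter‖ ≤ (p : ℝ)⁻¹) →
      ∀ (K₀ : Type) [Field K₀] [NumberField K₀] (ε₀ : DirichletCharacter ℚ_[p] (NumberField.discr K₀).natAbs),
        IsImaginaryQuadratic K₀ → Odd (NumberField.discr K₀) → NumberField.discr K₀ < -4 →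
        ¬ ((3 : ℤ) ∣ NumberField.discr K₀) →
        (∀ q' : ℕ, q'.Prime → q' ∣ m → q' ≠ 2 → jacobiSym (NumberField.discr K₀) q' = τ q') →
        NumberField.discr K₀ % 8 = 5 → IsKroneckerCharacterOf K₀ ε₀ →
        ‖(k : ℚ_[p])⁻¹ * @generalizedBernoulli ℚ_[p] _ _
            (changeLevel (dvd_mul_right m (NumberField.discr K₀).natAbs) χ *
              changeLevel (dvd_mul_left (NumberField.discr K₀).natAbs m) ε₀).conductor ⟨conductor_ne_zero _⟩ k
            (changeLevel (dvd_mul_right m (NumberField.discr K₀).natAbs) χ *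
              changeLevel (dvd_mul_left (NumberField.discr K₀).natAbs m) ε₀).primitiveCharacter‖ ≤ (p : ℝ)⁻¹) :
    ∀ (p : ℕ) [Fact p.Prime] (m : ℕ) [NeZero m] (χ : DirichletCharacter ℚ_[p] m) (k : ℕ),
      (p = 7 ∨ p = 11 ∨ p = 19 ∨ p = 43 ∨ p = 67 ∨ p = 163) →
      m.Coprime p → χ.IsPrimitive → χ.IsQuadratic → (k = (p + 1) / 4 ∨ k = (3 * p - 1) / 4) →
      2 ≤ k → k ≤ p - 2 → χ (-1) * (-1) ^ k = -1 →
      ¬ ((∀ q : ℕ, q.Prime → q ∣ m → q ≠ 2 → jacobiSym (-(p : ℤ)) q = 1) ∧ (2 ∣ m → p % 8 = 7)) →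
      (∃ ℓ : ℕ, ℓ.Prime ∧ ℓ ∣ m ∧ (ℓ % p = 1 ∨ ℓ % p = p - 1)) →
      Q p m χ k →
      ¬ ‖((p - k : ℕ) : ℚ_[p])⁻¹ * generalizedBernoulli (p - k) χ‖ ≤ (p : ℝ)⁻¹ →
      ∃ (K₀ : Type) (_ : Field K₀) (_ : NumberField K₀) (ε₀ : DirichletCharacter ℚ_[p] (NumberField.discr K₀).natAbs),
        IsImaginaryQuadratic K₀ ∧
        (∀ q : ℕ, q.Prime → q ∣ m → ((Ideal.span {(q : ℤ)}).primesOver (𝓞 K₀)).ncard = 2) ∧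
        Odd (NumberField.discr K₀) ∧ NumberField.discr K₀ < -4 ∧ IsKroneckerCharacterOf K₀ ε₀ ∧
        ¬ ‖(k : ℚ_[p])⁻¹ * @generalizedBernoulli ℚ_[p] _ _
            (changeLevel (dvd_mul_right m (NumberField.discr K₀).natAbs) χ *
              changeLevel (dvd_mul_left (NumberField.discr K₀).natAbs m) ε₀).conductor ⟨conductor_ne_zero _⟩ k
            (changeLevel (dvd_mul_right m (NumberField.discr K₀).natAbs) χ *
              changeLevel (dvd_mul_left (NumberField.discr K₀).natAbs m) ε₀).primitiveCharacter‖ ≤ (p : ℝ)⁻¹ := by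
  intro p _ m _ χ k hp6 hmp hχ hχq hk hk2 hkp hpar hoff hexc _hQ hreg
  have hpp : p.Prime := Fact.out
  have hp3 : p % 4 = 3 := by rcases hp6 with h | h | h | h | h | h <;> subst h <;> norm_num
  have h7 : 7 ≤ p := by rcases hp6 with h | h | h | h | h | h <;> omega
  have hp2 : p ≠ 2 := by omega
  have hm0 : m ≠ 0 := NeZero.ne m
  by_contra H
  have hV1 : ∀ (K₀ : Type) [Field K₀] [NumberField K₀] (ε₀ : DirichletCharacter ℚ_[p] (NumberField.discr K₀).natAbs),
      IsImaginaryQuadratic K₀ → Odd (NumberField.discr K₀) → NumberField.discr K₀ < -4 →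
      ¬ ((3 : ℤ) ∣ NumberField.discr K₀) →
      (∀ q' : ℕ, q'.Prime → q' ∣ m → q' ≠ 2 → jacobiSym (NumberField.discr K₀) q' = (fun _ : ℕ => (1 : ℤ)) q') →
      (2 ∣ m → NumberField.discr K₀ % 8 = 1) → IsKroneckerCharacterOf K₀ ε₀ →
      ‖(k : ℚ_[p])⁻¹ * @generalizedBernoulli ℚ_[p] _ _
            (changeLevel (dvd_mul_right m (NumberField.discr K₀).natAbs) χ *
              changeLevel (dvd_mul_left (NumberField.discr K₀).natAbs m) ε₀).conductor ⟨conductor_ne_zero _⟩ k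
            (changeLevel (dvd_mul_right m (NumberField.discr K₀).natAbs) χ *
              changeLevel (dvd_mul_left (NumberField.discr K₀).natAbs m) ε₀).primitiveCharacter‖ ≤ (p : ℝ)⁻¹ := by
    intro K₀ _ _ ε₀ hK hodd hlt _h3 hpat h8 hε
    by_contra hunit
    apply H
    refine ⟨K₀, inferInstance, inferInstance, ε₀, hK, ?_, hodd, hlt, hε, hunit⟩
    intro q hq hqm
    by_cases hq2 : q = 2
    · subst hq2
      have h := (Quadratic.ncard_primesOver_two_eq_two_iff hK.1).mpr (h8 hqm)
      simpa using h
    · rw [Quadratic.ncard_primesOver_eq_two_iff_jacobiSym hK.1 hq hq2]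
      exact hpat q hq hqm hq2
  set Qoff : Finset ℕ := m.primeFactors.filter (fun q => q ≠ 2 ∧ jacobiSym (-(p : ℤ)) q = -1) with hQoff
  have hstep : ∀ S : Finset ℕ, S ⊆ Qoff →
      ∀ (K₀ : Type) [Field K₀] [NumberField K₀] (ε₀ : DirichletCharacter ℚ_[p] (NumberField.discr K₀).natAbs),
      IsImaginaryQuadratic K₀ → Odd (NumberField.discr K₀) → NumberField.discr K₀ < -4 →
      ¬ ((3 : ℤ) ∣ NumberField.discr K₀) →
      (∀ q' : ℕ, q'.Prime → q' ∣ m → q' ≠ 2 →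
        jacobiSym (NumberField.discr K₀) q' = (fun x : ℕ => if x ∈ S then (-1 : ℤ) else 1) q') →
      (2 ∣ m → NumberField.discr K₀ % 8 = 1) → IsKroneckerCharacterOf K₀ ε₀ →
      ‖(k : ℚ_[p])⁻¹ * @generalizedBernoulli ℚ_[p] _ _
            (changeLevel (dvd_mul_right m (NumberField.discr K₀).natAbs) χ *
              changeLevel (dvd_mul_left (NumberField.discr K₀).natAbs m) ε₀).conductor ⟨conductor_ne_zero _⟩ k
            (changeLevel (dvd_mul_right m (NumberField.discr K₀).natAbs) χ *
              changeLevel (dvd_mul_left (NumberField.discr K₀).natAbs m) ε₀).primitiveCharacter‖ ≤ (p : ℝ)⁻¹ := by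
    intro S
    induction S using Finset.induction_on with
    | empty =>
      intro _ K₀ _ _ ε₀ hK hodd hlt h3 hpat h8 hε
      exact hV1 K₀ ε₀ hK hodd hlt h3 (fun q' hq' hq'm hq'2 => by simpa using hpat q' hq' hq'm hq'2) h8 hε
    | @insert q S hqS ih =>
      intro hsub
      have hqQ : q ∈ Qoff := hsub (Finset.mem_insert_self q S)
      have hS : S ⊆ Qoff := fun x hx => hsub (Finset.mem_insert_of_mem hx)
      have hqQ' : q ∈ m.primeFactors ∧ q ≠ 2 ∧ jacobiSym (-(p : ℤ)) q = -1 := by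
        simpa [hQoff, Finset.mem_filter] using hqQ
      obtain ⟨hqpf, hq2, -⟩ := hqQ'
      have hq : q.Prime := Nat.prime_of_mem_primeFactors hqpf
      have hqm : q ∣ m := Nat.dvd_of_mem_primeFactors hqpf
      have hτ : ∀ q' : ℕ, q'.Prime → q' ∣ m → q' ≠ 2 →
          ((fun x : ℕ => if x ∈ S then (-1 : ℤ) else 1) q' = 1 ∨ (fun x : ℕ => if x ∈ S then (-1 : ℤ) else 1) q' = -1) := by
        intro q' _ _ _
        by_cases h : q' ∈ S <;> simp [h]
      have hflip := hFlipAll p m χ k hp6 hmp hχ hχq hk hk2 hkp hpar (fun x : ℕ => if x ∈ S then (-1 : ℤ) else 1) q hq hqm hq2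
        hτ (ih hS)
      intro K₀ _ _ ε₀ hK hodd hlt h3 hpat h8 hε
      refine hflip K₀ ε₀ hK hodd hlt h3 ?_ h8 hε
      intro q' hq' hq'm hq'2
      rw [hpat q' hq' hq'm hq'2]
      by_cases hqq : q' = q
      · subst hqq
        simp [hqS]
      · simp [Finset.mem_insert, hqq]
  have hVQ := hstep Qoff subset_rfl
  have hτQ : ∀ q' : ℕ, q'.Prime → q' ∣ m → q' ≠ 2 →
      ((fun x : ℕ => if x ∈ Qoff then (-1 : ℤ) else 1) q' = 1 ∨ (fun x : ℕ => if x ∈ Qoff then (-1 : ℤ) else 1) q' = -1) := by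
    intro q' _ _ _
    by_cases h : q' ∈ Qoff <;> simp [h]
  have hpatQ : ∀ q' : ℕ, q'.Prime → q' ∣ m → q' ≠ 2 →
      jacobiSym (-(p : ℤ)) q' = (fun x : ℕ => if x ∈ Qoff then (-1 : ℤ) else 1) q' := by
    intro q' hq' hq'm hq'2
    have hq'p : q' ≠ p := by
      rintro rfl
      have : Nat.Coprime q' q' := Nat.Coprime.coprime_dvd_left hq'm hmp
      rw [Nat.coprime_self] at this
      exact hq'.ne_one this
    by_cases hmem : q' ∈ Qoff
    · have hmem' : q' ∈ m.primeFactors ∧ q' ≠ 2 ∧ jacobiSym (-(p : ℤ)) q' = -1 := by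
        simpa [hQoff, Finset.mem_filter] using hmem
      simp only [hmem, if_true]
      exact hmem'.2.2
    · simp only [hmem, if_false]
      have hgcd : Int.gcd (-(p : ℤ)) q' = 1 := by
        rw [Int.neg_gcd, Int.gcd_natCast_natCast]
        exact (Nat.coprime_primes hpp hq').mpr (Ne.symm hq'p)
      rcases jacobiSym.eq_one_or_neg_one hgcd with h1 | h1
      · exact h1
      · exfalso
        apply hmem
        simp only [hQoff, Finset.mem_filter, Nat.mem_primeFactors]
        exact ⟨⟨hq', hq'm, hm0⟩, hq'2, h1⟩
  obtain ⟨K₀, iF, iN, ε₀, hK, hd, hε, himp⟩ := exists_cmField_fieldFactor_le_imp hp6 m χ k hmp hχ hk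
  have hoddp : Odd (NumberField.discr K₀) := by
    rw [hd]
    exact (Int.odd_coe_nat p |>.mpr (hpp.eq_two_or_odd'.resolve_left hp2)).neg
  have hltp : NumberField.discr K₀ < -4 := by rw [hd]; omega
  have h3p : ¬ ((3 : ℤ) ∣ NumberField.discr K₀) := by
    rw [hd, Int.dvd_neg]
    intro h3
    have h3' : 3 ∣ p := by exact_mod_cast h3
    have := (Nat.prime_dvd_prime_iff_eq Nat.prime_three hpp).mp h3'
    omega
  have hpatp : ∀ q' : ℕ, q'.Prime → q' ∣ m → q' ≠ 2 →
      jacobiSym (NumberField.discr K₀) q' = (fun x : ℕ => if x ∈ Qoff then (-1 : ℤ) else 1) q' := by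
    intro q' hq' hq'm hq'2
    rw [hd]
    exact hpatQ q' hq' hq'm hq'2
  apply hreg
  apply himp
  by_cases h8 : 2 ∣ m → p % 8 = 7
  · refine hVQ K₀ ε₀ hK hoddp hltp h3p hpatp ?_ hε
    intro h2m
    rw [hd]
    have := h8 h2m
    omega
  · have h2m : 2 ∣ m := by
      by_contra h2
      exact h8 (fun h => absurd h h2)
    have hp8 : p % 8 ≠ 7 := fun h => h8 (fun _ => h)
    have hV5 := hFlipTwo p m χ k hp6 hmp hχ hχq hk hk2 hkp hpar h2m (fun x : ℕ => if x ∈ Qoff then (-1 : ℤ) else 1) hτQ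
      (fun K₁ _ _ ε₁ hK₁ hodd₁ hlt₁ h3₁ hpat₁ h8₁ hε₁ => hVQ K₁ ε₁ hK₁ hodd₁ hlt₁ h3₁ hpat₁ (fun _ => h8₁) hε₁)
    refine hV5 K₀ ε₀ hK hoddp hltp h3p hpatp ?_ hε
    rw [hd]
    omega

end Summit.BirchSwinnertonDyer.BirchSwinnertonDyer.Theorems.PrintCFram.FlipRung

end
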